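import Summits.BirchSwinnertonDyer.Rank1Residual.P2.Conjectures.CongruentNumberSilentEvenFiveAtTwo
import HarnessLib

/-!
# Cell «bsd-monsky» (prover-B): the Lean HOOK of PROOF-B's Theorem B — «`𝓛(2pq)` is ODD» ⟹ C-P2-1
# (both forms) on `𝒮⁻`, and the whole even-five family — nothing asserted

HONEST FRAMING (cell `bsd-monsky`, run/shared/lean/pub/bsd-monsky/; README §1): this file asserts NO arithmetic
fact. PROOF-B (`HOME/proof/PROOF-B.md`, prover-B; v1.1 PASSED the cross-family referee 2026-08-25,
`HOME/REFEREE-VERDICT-B.md`; v1.2 = two locator-range fixes) proves, by the Tian–Yuan–Zhang genus-point recursion and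
ONE new descent operator `θ` (a lift of the generator `σ_{1+ϖ}` of `Gal(H′_N/H_N) ≅ ℤ/4`), the statement

  THEOREM B. `p ≡ 5 (mod 8)`, `q ≡ 3 (mod 4)` primes, `N = 2pq`, `g(N) = #2Cl(ℚ(√−2pq))` odd ⟹ `𝓛(N)` is an ODD integer,

where `g(N)` is odd on ALL of `𝒮⁻ = {(p/q) = −1}` by Rédei (PROOF-B Lemma 2 = the tree's
`P2.odd_genusClassNumber_genusField_two_mul_five_mul_iff`, modulo the named fact `redeiReichardt_fourTwoCard_classGroup`).
Its OUTPUT SHAPE in tree currency is `∃ L : ℤ, Odd L ∧ IsScriptL (2pq) L` — the same currency the landed `𝒮⁺` theorem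
`P2.forall_bsdp_two_congruentNumberCurve_two_mul_five_mul` runs on (there from U⁺ and `Σ₂′(2pq)` odd; on `𝒮⁻` the sum
`Σ₂′` is EVEN and U⁺ is silent). This file is the one-step bridge from that shape to the two `@[conjecture]` `Prop`s of
C-P2-1 (`Conjectures/CongruentNumberSilentEvenFiveAtTwo.lean`):

* §1 `congruentSilentEvenFiveOrdTwo_of_odd_scriptL`: (`hB` : on `𝒮⁻`, `∃ L` odd with `IsScriptL (2pq) L`) ⟹ the
  `Ш_an`-unit form (`x = 2^{2k−2−a}·L² = 4L²`, `ord₂ x = 2`), with `ord_{s=1} L(E_{2pq}, s) = 1` recovered INSIDE the tree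
  from `𝓛 ≠ 0` and the root number (`analyticRank_congruentNumberCurve_eq_one_of_isScriptL`) — NO `h515`, NO GZK binder;
  `analyticRank_eq_one_of_odd_scriptL` records clause (a) alone; `…BSDTwo_of_odd_scriptL` adds Monsky 1990 Cor 5.15
  (`h515`: rank `1`, `#Sel₂ = 8`) through the landed equivalence of the two forms (door D-CN-5).
* §2 the same with PROOF-B's Theorem B taken VERBATIM as the hypothesis (`hThmB` : `g(2pq)` odd ⟹ `𝓛(2pq)` odd, for all
  `p ≡ 5 (mod 8)`, `q ≡ 3 (mod 4)`), the genus parity on `𝒮⁻` being discharged by the tree's Rédei computation (`hR`);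
  and the whole even-five family `BSD(E_{2pq}, 2)` for BOTH symbols from {`hTYZ`, `hGZK`, `hR`, `h515`, `hThmB`}.

So the cell's two routes now have byte-parallel hooks into the SAME consumer doors: PROOF-A's
(`congruentSilentEvenFiveOrdTwo_of_proofA`, shape `L′ = (4m²/u²)·Ω·Reg`) and PROOF-B's (this file, shape `𝓛(2pq)` odd);
the typer's tier-0 datum `OddIndexHeegnerDatum` sits between them (`oddIndexHeegnerDatum_of_odd_scriptL`). The hypotheses
`hB` / `hThmB` are exactly Theorem B of PROOF-B with its objects read in the tree (`IsScriptL`, `genusClassNumber ∘ GenusField`);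
they are HYPOTHESES here (the Lean enclosure of route B — a `θ`-display over TYZ Prop 3.2 / Thm 3.6 plus kernel work reusing
`W2.uPlus_genusField_of`'s E-side transfer — is the typer's / a successor's business, `HOME/lean/PLAN.md`). Nothing booked;
no mark moved.

References: HOME/proof/PROOF-B.md §1 (Theorem B, Lemma R, Corollary), §5 (Lemma 2), §8, §9; [TianYuanZhang2017] §1
(definition of `𝓛(n)`, (1.1)), Thm. 1.1, Thm. 3.3, Thm. 3.5; [Monsky1990MockHeegner] Cor. 5.15 (2′) (p. 66), Remark (3) (p. 67);
[LiMa2008] Thm. 0.4 (Rédei); [Miller2011LMS] Def. 1.1.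
-/

noncomputable section

open scoped Classical

open WeierstrassCurve NumberField Literature.NumberTheory.EllipticCurves
  Literature.NumberTheory.EllipticCurves.Rank1Residual
  Literature.NumberTheory.EllipticCurves.Rank1Residual.Typed
  Literature.NumberTheory.EllipticCurves.Monsky1990
  Literature.NumberTheory.EllipticCurves.TianYuanZhang2017
  Literature.NumberTheory.QuadraticFields.RedeiReichardt

set_option autoImplicit false

namespace Summit.BirchSwinnertonDyer.Rank1Residual.P2

open Conjectures

/-! ## §1 From «`𝓛(2pq)` odd on `𝒮⁻`» to C-P2-1 -/

/-- **PROOF-B output ⟹ clause (a) alone: `ord_{s=1} L(E_{2pq}, s) = 1` on `𝒮⁻`** — from `𝓛(2pq) ≠ 0` (so the analytic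
rank is `≤ 1`, TYZ's definition of `𝓛`) and the root number `−1` of `E_{2pq}`, `2pq ≡ 6 (mod 8)` (`L(E_{2pq}, 1) = 0`); pure
logic inside the tree (`analyticRank_congruentNumberCurve_eq_one_of_isScriptL`), no converse theorem, no GZK, no `h515`.
CONDITIONAL on `hB`. [cite: TianYuanZhang2017, §1 (definition of 𝓛(n), p0002 L46–L75; root number p0002 L25–L36)] -/
theorem analyticRank_eq_one_of_odd_scriptL
    (hB : ∀ p q : ℕ, p.Prime → q.Prime → p % 8 = 5 → q % 4 = 3 → jacobiSym p q = -1 →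
      ∃ L : ℤ, Odd L ∧ IsScriptL (2 * (p * q)) L)
    {p q : ℕ} (hp : p.Prime) (hq : q.Prime) (hp5 : p % 8 = 5) (hq4 : q % 4 = 3) (hj : jacobiSym p q = -1) :
    (congruentNumberCurve (2 * (p * q))).analyticRank = 1 := by
  obtain ⟨hN, -, -, -⟩ := isCor515Family_two_mul_five_mul hp hq hp5 hq4
  obtain ⟨L, hLodd, hL⟩ := hB p q hp hq hp5 hq4 hj
  have hL0 : L ≠ 0 := fun h => by simp [h] at hLodd
  exact analyticRank_congruentNumberCurve_eq_one_of_isScriptL hN.squarefree hN.mod_eight hL hL0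

/-- **PROOF-B output ⟹ C-P2-1, sharper (`Ш_an`-unit) form.** If for every `(p, q) ∈ 𝒮⁻` there is an ODD integer `L`
with `IsScriptL (2pq) L` (`L² = 𝓛(2pq)²`; PROOF-B Theorem B + Lemma R), then `CongruentSilentEvenFiveOrdTwo`: with
`ord_{s=1} L = 1` (previous theorem) the leading coefficient is `L′(E_{2pq}, 1) = 2^{2k−2−a}·L²·Ω·Reg` (TYZ (1.1) read
in the tree, `leadingLCoeff_congruentNumberCurve_eq_of_isScriptL`; `2k − 2 − a = 2` for `N = 2pq`), so
`x = 4L² ≠ 0` and `ord₂ x = 2`. No `h515`, no GZK. CONDITIONAL on `hB`; nothing asserted.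
[cite: TianYuanZhang2017, §1 ((1.1), p0002 L63–L75)] [cite: Miller2011LMS, Def. 1.1 (arXiv:1010.2431 p. 3)] -/
theorem congruentSilentEvenFiveOrdTwo_of_odd_scriptL
    (hB : ∀ p q : ℕ, p.Prime → q.Prime → p % 8 = 5 → q % 4 = 3 → jacobiSym p q = -1 →
      ∃ L : ℤ, Odd L ∧ IsScriptL (2 * (p * q)) L) :
    CongruentSilentEvenFiveOrdTwo := by
  intro p q hp hq hp5 hq4 hj
  obtain ⟨hN, hp2, hq2, hne⟩ := isCor515Family_two_mul_five_mul hp hq hp5 hq4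
  haveI := isElliptic_congruentNumberCurve hN.ne_zero
  obtain ⟨L, hLodd, hL⟩ := hB p q hp hq hp5 hq4 hj
  have hL0' : L ≠ 0 := fun h => by simp [h] at hLodd
  have hL0 : (L : ℚ) ≠ 0 := by exact_mod_cast hL0'
  have hr1 := analyticRank_congruentNumberCurve_eq_one_of_isScriptL hN.squarefree hN.mod_eight hL hL0'
  obtain ⟨he, -⟩ := twoExponent_tamagawa_two_mul_prime_mul hp hq hp2 hq2 hne
  refine ⟨(2 : ℚ) ^ twoExponent (2 * (p * q)) * (L : ℚ) ^ 2,
    mul_ne_zero (zpow_ne_zero _ two_ne_zero) (pow_ne_zero _ hL0), ?_, ?_⟩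
  · rw [← (leadingLCoeff_eq_deriv_of_analyticRank_eq_one hr1).1,
      leadingLCoeff_congruentNumberCurve_eq_of_isScriptL (Nat.pos_of_ne_zero hN.ne_zero) hr1 hL]
    push_cast
    ring
  · rw [padicValRat_two_zpow_mul_sq hLodd, he]

/-- **PROOF-B output ⟹ C-P2-1, observable form** (`ord_{s=1} L(E_{2pq}, s) = 1 ∧ BSD(E_{2pq}, 2)` on all of `𝒮⁻`),
through the landed equivalence of the two forms modulo Monsky 1990 Cor 5.15 (`h515`: rank one, `#Sel₂ = 8`, so
`Ш[2^∞] = 0`; door D-CN-5 reads `2 = ord₂ 2⁶ − 4`). PROOF-B §9 obtains the same Selmer row from Heath-Brown 1994's even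
Monsky matrix instead; either displayed fact serves. CONDITIONAL on `hB` and `h515`; nothing asserted.
[cite: Monsky1990MockHeegner, Cor. 5.15 (2′) (p. 66)] [cite: Miller2011LMS, Def. 1.1 (arXiv:1010.2431 p. 3)] -/
theorem congruentSilentEvenFiveBSDTwo_of_odd_scriptL
    (h515 : cor515_rank_eq_one_and_card_selmerGroup_two)
    (hB : ∀ p q : ℕ, p.Prime → q.Prime → p % 8 = 5 → q % 4 = 3 → jacobiSym p q = -1 →
      ∃ L : ℤ, Odd L ∧ IsScriptL (2 * (p * q)) L) :
    CongruentSilentEvenFiveBSDTwo :=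
  congruentSilentEvenFiveBSDTwo_of_ordTwo h515 (congruentSilentEvenFiveOrdTwo_of_odd_scriptL hB)

/-! ## §2 With Theorem B verbatim (`g(2pq)` odd ⟹ `𝓛(2pq)` odd) and Rédei for the genus parity on `𝒮⁻` -/

/-- **Rédei on `𝒮⁻` (PROOF-B Lemma R / Lemma 2):** for primes `p ≡ 5 (mod 8)`, `q ≡ 3 (mod 4)` with `(p/q) = −1`,
`g(2pq) = #2Cl(ℚ(√−2pq))` is ODD (both residue halves `q ≡ 3, 7 (mod 8)`): the tree's `3 × 3` Rédei-matrix computation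
`odd_genusClassNumber_genusField_two_mul_five_mul_iff` (kernel has `2` elements iff `q ≡ 3 (8)` or `(p/q) = −1`), modulo
Rédei–Reichardt (`hR`). [cite: LiMa2008, Thm. 0.4 with Lemma 0.1] [cite: TianYuanZhang2017, §1 (g(d), p0002 L78–L84)] -/
theorem odd_genusClassNumber_genusField_two_mul_five_mul_of_jacobiSym_neg
    (hR : redeiReichardt_fourTwoCard_classGroup) {p q : ℕ} (hp : p.Prime) (hq : q.Prime) (hp5 : p % 8 = 5)
    (hq4 : q % 4 = 3) (hj : jacobiSym p q = -1) :
    Odd (genusClassNumber (GenusField (2 * (p * q)))) := by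
  have hq2 : q ≠ 2 := by omega
  have hne : p ≠ q := fun h => by omega
  exact (odd_genusClassNumber_genusField_two_mul_five_mul_iff hR hp hq hp5 hq4).mpr
    (Or.inr ((kroneckerBit_of_jacobiSym hp hq hq2 hne).2 hj))

/-- **THEOREM B of PROOF-B (verbatim, as a hypothesis) ⟹ the `𝒮⁻` output shape**: with `hThmB` : for all primes
`p ≡ 5 (mod 8)`, `q ≡ 3 (mod 4)`, `g(2pq)` odd ⟹ `𝓛(2pq)² = L²` with `L` odd, and Rédei (`hR`) for `g(2pq)` odd on
`(p/q) = −1`, every member of `𝒮⁻` has `𝓛(2pq)` odd. CONDITIONAL on `hThmB`, `hR`.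
[cite: TianYuanZhang2017, Thm. 3.5 and §3] [cite: LiMa2008, Thm. 0.4] -/
theorem odd_scriptL_sMinus_of_theoremB (hR : redeiReichardt_fourTwoCard_classGroup)
    (hThmB : ∀ p q : ℕ, p.Prime → q.Prime → p % 8 = 5 → q % 4 = 3 →
      Odd (genusClassNumber (GenusField (2 * (p * q)))) → ∃ L : ℤ, Odd L ∧ IsScriptL (2 * (p * q)) L) :
    ∀ p q : ℕ, p.Prime → q.Prime → p % 8 = 5 → q % 4 = 3 → jacobiSym p q = -1 →
      ∃ L : ℤ, Odd L ∧ IsScriptL (2 * (p * q)) L :=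
  fun _ _ hp hq hp5 hq4 hj =>
    hThmB _ _ hp hq hp5 hq4 (odd_genusClassNumber_genusField_two_mul_five_mul_of_jacobiSym_neg hR hp hq hp5 hq4 hj)

/-- **THEOREM B ⟹ C-P2-1 (observable form) on `𝒮⁻`**, modulo Rédei–Reichardt (`hR`) and Monsky 1990 Cor 5.15 (`h515`).
CONDITIONAL on `hThmB`; nothing asserted. [cite: Monsky1990MockHeegner, Cor. 5.15 (2′) (p. 66), Remark (3) (p. 67)]
[cite: Miller2011LMS, Def. 1.1 (arXiv:1010.2431 p. 3)] -/
theorem congruentSilentEvenFiveBSDTwo_of_theoremB (hR : redeiReichardt_fourTwoCard_classGroup)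
    (h515 : cor515_rank_eq_one_and_card_selmerGroup_two)
    (hThmB : ∀ p q : ℕ, p.Prime → q.Prime → p % 8 = 5 → q % 4 = 3 →
      Odd (genusClassNumber (GenusField (2 * (p * q)))) → ∃ L : ℤ, Odd L ∧ IsScriptL (2 * (p * q)) L) :
    CongruentSilentEvenFiveBSDTwo :=
  congruentSilentEvenFiveBSDTwo_of_odd_scriptL h515 (odd_scriptL_sMinus_of_theoremB hR hThmB)

/-- **`BSD(E_{2pq}, 2)` on the WHOLE even-five two-prime family, both symbols, with route B on `𝒮⁻`**: the binders of the
landed `𝒮⁺` theorem (`hTYZ`, `hGZK`, `hR`, `h515`) plus Theorem B (`hThmB`). (PROOF-B §10: `θ` also re-proves the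
`𝒮⁺ ∩ {q ≡ 3 (8)}` rows; the `(p/q) = +1`, `q ≡ 7 (8)` rows need TYZ's own `β`, i.e. the `𝒮⁺` theorem.) CONDITIONAL on
the five binders; nothing asserted. [cite: TianYuanZhang2017, Thm. 1.2, Thm. 3.5 and §1 (1.1)]
[cite: Monsky1990MockHeegner, Cor. 5.15 (2′) (p. 66)] [cite: Miller2011LMS, Def. 1.1 (arXiv:1010.2431 p. 3)] -/
theorem forall_bsdp_two_congruentNumberCurve_two_mul_five_mul_of_theoremB
    (hTYZ : tyz_genusPointData) (hGZK : rank_eq_analyticRank_of_analyticRank_le_one)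
    (hR : redeiReichardt_fourTwoCard_classGroup) (h515 : cor515_rank_eq_one_and_card_selmerGroup_two)
    (hThmB : ∀ p q : ℕ, p.Prime → q.Prime → p % 8 = 5 → q % 4 = 3 →
      Odd (genusClassNumber (GenusField (2 * (p * q)))) → ∃ L : ℤ, Odd L ∧ IsScriptL (2 * (p * q)) L) :
    ∀ p q : ℕ, p.Prime → q.Prime → p % 8 = 5 → q % 4 = 3 →
      BSDp (congruentNumberCurve (2 * (p * q))) 2 :=
  forall_bsdp_two_congruentNumberCurve_two_mul_five_mul_of_conjecture hTYZ hGZK hR h515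
    (congruentSilentEvenFiveBSDTwo_of_theoremB hR h515 hThmB)

end Summit.BirchSwinnertonDyer.Rank1Residual.P2

end
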